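import Mathlib
import Literature.Analysis.FluidPDE.GaussianVortexPlanar
import Literature.Analysis.FluidPDE.GaussianVortexPlanarProofs
import HarnessLib

/-!
# Helpers for stub `stub_coreInverse` of the line `braid-closed-large-circulation-gluing`
# (crux stmt-AnomalousDissipation-3009, `MarginalStabilityChain.StretchedVortexRows`)

Two structural facts about the linearisation `Λ_G w = v^G·∇w + (K∗w)·∇G` of the transport term at the Gaussian vortex
(`G = gaussVortexProfile`, `v^G = gaussVortexVelocity`, `K∗w = biotSavart2D w`), which are the BLOCK STRUCTURE behind the
core inverse (`stub_coreInverse`) and the kernel theorem behind the cell problems (`stub_cellSolvability`):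

* **The rotation multiplier, pointwise.** `⟪v^G ξ, ∇w ξ⟫ = Ω(ξ) · ∂_θ w(ξ)` where `∂_θ w(ξ) := Dw(ξ)[ξ^⊥]` is the angular
  derivative and `Ω(ξ) = (8π)⁻¹ φ(|ξ|²/4) > 0` the angular velocity of the Gaussian vortex
  (`inner_gaussVortexVelocity_gradient_eq_mul_angularDeriv`); hence `⟪v^G ξ, ∇w ξ⟫ · ∂_θw(ξ) = Ω(ξ) (∂_θ w(ξ))² ≥ 0`
  (`inner_gaussVortexVelocity_gradient_mul_angularDeriv_nonneg`): pairing the rotation term `αΛ_G w` with the angular derivative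
  `∂_θ w` is COERCIVE on non-radial functions with weight `αΩ` — the energy form of the "fast-rotation stabilising effect" at spectral
  parameter `0` (Li–Wei–Zhang, arXiv:1701.06269, Lemma 5.2 supplies the matching bound for the nonlocal part).
* **Radial functions are in the kernel of `Λ_G`.** For `h` radial (`‖ξ‖ = ‖η‖ → h ξ = h η`), `∂_θ h = 0` (`fderiv_perp_eq_zero_of_radial`:
  `h` is constant along the circle `t ↦ cos t·ξ + sin t·ξ^⊥`), so `⟪v^G ξ, ∇h ξ⟫ = 0`; and the Biot–Savart velocity of a radial density is
  azimuthal (tree: `inner_biotSavart2D_eq_zero_of_radial`, by the reflection across `ℝξ`), while `∇G(ξ) = −(G(ξ)/2) ξ` is radial, so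
  `⟪(K∗h)(ξ), ∇G(ξ)⟫ = 0`. Together: `Λ_G h = 0` pointwise (`lamG_eq_zero_of_radial`) — the `X₀ ⊆ ker Λ` half of Maekawa's kernel
  theorem (Li–Wei–Zhang Lemma 2.3; Gallay–Wayne 2005), with NO differentiability or integrability hypothesis (Mathlib's junk values
  `fderiv = 0` / `∫ = 0` make both sides vanish in the degenerate cases).

References: Th. Gallay, C. E. Wayne, Comm. Math. Phys. 255 (2005) §4.2; T. Li, D. Wei, Z. Zhang, Ann. Sci. ÉNS 53 (2020)
= arXiv:1701.06269, Lemma 2.3 and Lemma 5.2; Th. Gallay, Y. Maekawa, arXiv:1610.08384 §4.1.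
-/

set_option linter.dupNamespace false

noncomputable section

open scoped RealInnerProductSpace Topology
open MeasureTheory WithLp

namespace Summit.AnomalousDissipation.AnomalousDissipation.Theorems.MarginalStabilityChainStretchedVortexRows

open Literature.Analysis.FluidPDE

/-! ### The circle through `ξ` and the angular derivative -/

/-- The circle through `ξ`: `γ_ξ(t) = cos t · ξ + sin t · ξ^⊥`. [folklore] -/
theorem norm_cos_smul_add_sin_smul_perp (ξ : EuclideanSpace ℝ (Fin 2)) (t : ℝ) :
    ‖Real.cos t • ξ + Real.sin t • perp ξ‖ = ‖ξ‖ := by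
  have h0 : ⟪ξ, perp ξ⟫ = 0 := inner_self_perp ξ
  have hsq : ‖Real.cos t • ξ + Real.sin t • perp ξ‖ ^ 2 = ‖ξ‖ ^ 2 := by
    rw [norm_add_sq_real, norm_smul, norm_smul, inner_smul_left, inner_smul_right, h0, norm_perp,
      Real.norm_eq_abs, Real.norm_eq_abs, mul_pow, mul_pow, sq_abs, sq_abs]
    simp only [mul_zero, add_zero]
    nlinarith [Real.cos_sq_add_sin_sq t]
  have h1 : 0 ≤ ‖Real.cos t • ξ + Real.sin t • perp ξ‖ := norm_nonneg _
  have h2 : 0 ≤ ‖ξ‖ := norm_nonneg _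
  nlinarith [hsq, h1, h2, sq_nonneg (‖Real.cos t • ξ + Real.sin t • perp ξ‖ - ‖ξ‖),
    sq_nonneg (‖Real.cos t • ξ + Real.sin t • perp ξ‖ + ‖ξ‖)]

/-- The circle through `ξ` passes through `ξ` at `t = 0` with velocity `ξ^⊥`. [folklore] -/
theorem hasDerivAt_cos_smul_add_sin_smul_perp (ξ : EuclideanSpace ℝ (Fin 2)) :
    HasDerivAt (fun t : ℝ => Real.cos t • ξ + Real.sin t • perp ξ) (perp ξ) 0 := by
  have h1 : HasDerivAt (fun t : ℝ => Real.cos t • ξ) ((-Real.sin 0) • ξ) 0 :=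
    (Real.hasDerivAt_cos 0).smul_const ξ
  have h2 : HasDerivAt (fun t : ℝ => Real.sin t • perp ξ) (Real.cos 0 • perp ξ) 0 :=
    (Real.hasDerivAt_sin 0).smul_const (perp ξ)
  have h := h1.add h2
  simp only [Real.sin_zero, neg_zero, zero_smul, Real.cos_zero, one_smul, zero_add] at h
  exact h

/-- **A radial function has vanishing angular derivative**: if `h ξ = h η` whenever `‖ξ‖ = ‖η‖`, then `Dh(ξ)[ξ^⊥] = 0`
(no differentiability assumed: at a point of non-differentiability `fderiv` is `0`). [folklore] -/
theorem fderiv_perp_eq_zero_of_radial {h : EuclideanSpace ℝ (Fin 2) → ℝ}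
    (hrad : ∀ ξ η : EuclideanSpace ℝ (Fin 2), ‖ξ‖ = ‖η‖ → h ξ = h η) (ξ : EuclideanSpace ℝ (Fin 2)) :
    fderiv ℝ h ξ (perp ξ) = 0 := by
  by_cases hd : DifferentiableAt ℝ h ξ
  · -- `h ∘ γ_ξ` is constant, and its derivative at `0` is `Dh(ξ)[ξ^⊥]`
    set γ : ℝ → EuclideanSpace ℝ (Fin 2) := fun t => Real.cos t • ξ + Real.sin t • perp ξ with hγ
    have hγ0 : γ 0 = ξ := by simp [hγ]
    have hconst : ∀ t, h (γ t) = h ξ := fun t => hrad _ _ (norm_cos_smul_add_sin_smul_perp ξ t)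
    have hcomp : HasDerivAt (fun t => h (γ t)) (fderiv ℝ h ξ (perp ξ)) 0 := by
      have hd' : HasFDerivAt h (fderiv ℝ h ξ) (γ 0) := by rw [hγ0]; exact hd.hasFDerivAt
      exact hd'.comp_hasDerivAt 0 (hasDerivAt_cos_smul_add_sin_smul_perp ξ)
    have hzero : HasDerivAt (fun t => h (γ t)) 0 0 := by
      have : (fun t => h (γ t)) = fun _ => h ξ := funext hconst
      rw [this]; exact hasDerivAt_const 0 (h ξ)
    exact hcomp.unique hzero
  · rw [fderiv_zero_of_not_differentiableAt hd]; rfl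

/-! ### The rotation multiplier -/

/-- **`v^G·∇w = Ω ∂_θ w` pointwise**: `⟪v^G(ξ), ∇w(ξ)⟫ = (8π)⁻¹ φ(|ξ|²/4) · Dw(ξ)[ξ^⊥]` with `φ = burgersPhi`
(`Ω(ξ) = (8π)⁻¹φ(|ξ|²/4) = (1 − e^{−|ξ|²/4})/(2π|ξ|²)` is the angular velocity of the Gaussian vortex). [folklore] -/
theorem inner_gaussVortexVelocity_gradient_eq_mul_angularDeriv (w : EuclideanSpace ℝ (Fin 2) → ℝ)
    (ξ : EuclideanSpace ℝ (Fin 2)) :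
    ⟪gaussVortexVelocity ξ, gradient w ξ⟫ =
      (8 * Real.pi)⁻¹ * burgersPhi (‖ξ‖ ^ 2 / 4) * fderiv ℝ w ξ (perp ξ) := by
  rw [gaussVortexVelocity, inner_smul_left, inner_gradient_right]
  simp

/-- **The rotation multiplier is coercive on the angular derivative**:
`⟪v^G(ξ), ∇w(ξ)⟫ · Dw(ξ)[ξ^⊥] = Ω(ξ) (Dw(ξ)[ξ^⊥])² ≥ 0`. Integrated against `G⁻¹`, this is
`⟨v^G·∇w, ∂_θ w⟩_{L²(G⁻¹)} = ∫ G⁻¹ Ω |∂_θ w|² ≥ 0`, the energy form of the fast-rotation stabilising effect used for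
`stub_coreInverse` at spectral parameter `0`. [folklore] -/
theorem inner_gaussVortexVelocity_gradient_mul_angularDeriv_nonneg (w : EuclideanSpace ℝ (Fin 2) → ℝ)
    (ξ : EuclideanSpace ℝ (Fin 2)) :
    0 ≤ ⟪gaussVortexVelocity ξ, gradient w ξ⟫ * fderiv ℝ w ξ (perp ξ) := by
  rw [inner_gaussVortexVelocity_gradient_eq_mul_angularDeriv]
  have hφ : 0 ≤ (8 * Real.pi)⁻¹ * burgersPhi (‖ξ‖ ^ 2 / 4) :=
    mul_nonneg (by positivity) (burgersPhi_pos _).le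
  have : (8 * Real.pi)⁻¹ * burgersPhi (‖ξ‖ ^ 2 / 4) * fderiv ℝ w ξ (perp ξ) * fderiv ℝ w ξ (perp ξ) =
      (8 * Real.pi)⁻¹ * burgersPhi (‖ξ‖ ^ 2 / 4) * (fderiv ℝ w ξ (perp ξ)) ^ 2 := by ring
  rw [this]
  exact mul_nonneg hφ (sq_nonneg _)

/-! ### Radial functions lie in the kernel of `Λ_G` -/

/-- For a radial `h`, `⟪v^G(ξ), ∇h(ξ)⟫ = 0` (the Gaussian vortex does not transport radial profiles). [folklore] -/
theorem inner_gaussVortexVelocity_gradient_eq_zero_of_radial {h : EuclideanSpace ℝ (Fin 2) → ℝ}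
    (hrad : ∀ ξ η : EuclideanSpace ℝ (Fin 2), ‖ξ‖ = ‖η‖ → h ξ = h η) (ξ : EuclideanSpace ℝ (Fin 2)) :
    ⟪gaussVortexVelocity ξ, gradient h ξ⟫ = 0 := by
  rw [inner_gaussVortexVelocity_gradient_eq_mul_angularDeriv, fderiv_perp_eq_zero_of_radial hrad, mul_zero]

/-- `∇G(ξ)` is radial: `⟪u, ∇G(ξ)⟫ = −(G(ξ)/2) ⟪ξ, u⟫`. [folklore] -/
theorem inner_gradient_gaussVortexProfile (u ξ : EuclideanSpace ℝ (Fin 2)) :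
    ⟪u, gradient gaussVortexProfile ξ⟫ = -(gaussVortexProfile ξ / 2) * ⟪ξ, u⟫ := by
  rw [inner_gradient_right]
  simp [fderiv_gaussVortexProfile_apply]

/-- For a radial density `h`, `⟪(K∗h)(ξ), ∇G(ξ)⟫ = 0`: the Biot–Savart velocity of a radial density is azimuthal
(tree: `inner_biotSavart2D_eq_zero_of_radial`, reflection across `ℝξ`) and `∇G` is radial. No integrability is assumed: where the
Biot–Savart integral diverges, `biotSavart2D h ξ = 0` by definition of the Bochner integral. [folklore] -/
theorem inner_biotSavart2D_gradient_gaussVortexProfile_eq_zero_of_radial {h : EuclideanSpace ℝ (Fin 2) → ℝ}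
    (hrad : ∀ ξ η : EuclideanSpace ℝ (Fin 2), ‖ξ‖ = ‖η‖ → h ξ = h η) (ξ : EuclideanSpace ℝ (Fin 2)) :
    ⟪biotSavart2D h ξ, gradient gaussVortexProfile ξ⟫ = 0 := by
  rw [inner_gradient_gaussVortexProfile]
  by_cases hint : Integrable (fun η => h η • biotSavartKernel2D (ξ - η))
  · rw [inner_biotSavart2D_eq_zero_of_radial hrad ξ hint, mul_zero]
  · have : biotSavart2D h ξ = 0 := integral_undef hint
    rw [this, inner_zero_right, mul_zero]

/-- **Radial functions are in the kernel of `Λ_G`** (the `X₀ ⊆ ker Λ` half of the kernel theorem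
`ker Λ = X₀ ⊕ span{∂₁G, ∂₂G}`, Li–Wei–Zhang Lemma 2.3 / Maekawa 2011): for radial `h`,
`Λ_G h(ξ) = ⟪v^G(ξ), ∇h(ξ)⟫ + ⟪(K∗h)(ξ), ∇G(ξ)⟫ = 0` at EVERY point, in the pointwise form used by `stub_cellSolvability` and
`stub_coreInverse` (so the radial block of the core operator is `L` alone: the rotation has no radial→radial part).
[cite: GallayMaekawa2016, §2] -/
theorem lamG_eq_zero_of_radial :
    ∀ h : EuclideanSpace ℝ (Fin 2) → ℝ, (∀ ξ η : EuclideanSpace ℝ (Fin 2), ‖ξ‖ = ‖η‖ → h ξ = h η) →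
      ∀ ξ : EuclideanSpace ℝ (Fin 2),
        ⟪gaussVortexVelocity ξ, gradient h ξ⟫ + ⟪biotSavart2D h ξ, gradient gaussVortexProfile ξ⟫ = 0 := by
  intro h hrad ξ
  rw [inner_gaussVortexVelocity_gradient_eq_zero_of_radial hrad,
    inner_biotSavart2D_gradient_gaussVortexProfile_eq_zero_of_radial hrad, add_zero]

end Summit.AnomalousDissipation.AnomalousDissipation.Theorems.MarginalStabilityChainStretchedVortexRows

end
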